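import Summits.Ventures.PackingBounds.Configurations.SixHundredCellFrame
import Summits.Ventures.PackingBounds.Configurations.CliqueFrame
import Summits.Ventures.PackingBounds.Configurations.SixHundredCell
import Summits.Ventures.PackingBounds.Configurations.SixHundredCellEnergyRigidity

/-!
# Uniqueness of the 600-cell as a `120`-point code of angle `36°` / `120`-point ground state on `S³`

Framing: lottery ticket; floor = certified bounds/negative ranges. Venture `PackingBounds` (cell
`pub-packcert`, seat `pub-packcert-energy`) — uniqueness of the 600-cell, step 4 (after
`SixHundredCellCodeDesign`, `SixHundredCellCodeCounts`, `SixHundredCellFrame`).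

**Theorem** (`isometric`, `isometric_pts`). Any two `120`-point codes in `ℝ⁴` with pairwise inner products
`≤ (1+√5)/4` are isometric; each is an isometric image of the 600-cell `Config.SixHundredCell.pts`; with
`SixHundredCellEnergyRigidity` every `120`-point ground state of `(1+t)^k` (`k ≥ 18`) is (`isometric_pts_of_ckPow_energy_eq`).
In print: Boyvalenkov–Danev 2001 (uniqueness of the `120`-point `11`-design / of the `(4, 120, cos 36°)` code) and
Böröczky's equality analysis; the proof here is the clique-frame argument:

* a tetrahedral cell `a₀..a₃` of `C` (`SixHundredCellFrame.exists_frame`) is a `t`-frame, `t = (1+√5)/4`, hence a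
  basis of `ℝ⁴` (`CliqueFrame`); every `z ∈ C` is read off its profile `(⟪z, aⱼ⟫)ⱼ`, whose entries are among the
  nine values `(A_d + B_d √5)/4` (`val9`, digits `d < 9`; `SixHundredCellCodeDesign.inner_mem_of_card_eq_120`);
* the norm identity of `CliqueFrame.norm_identity`, an equation in `ℚ(√5)`, splits into two INTEGER equations on
  the digits (`testDigits`; `√5 ∉ ℚ` via `Zsqrtd.toReal_injective`), and a kernel enumeration of all `9⁴` digit
  strings shows that exactly `120` of them pass (`codeList`, `mem_codeList_of_test`, by `decide`);
* so `C` is the image of the fixed `120`-member family `famC a k = Σⱼ coefR k j • aⱼ` (`eq_image`), whose Gram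
  matrix does not depend on the frame (`CliqueFrame.inner_combo_combo`): isometric (`GramIsometry`).

## References
* P. Boyvalenkov, D. Danev, *Uniqueness of the 120-point spherical 11-design in four dimensions*,
  Arch. Math. 77 (2001) 360–368.
* H. Cohn, A. Kumar, J. Amer. Math. Soc. 20 (2007) 99–148, Table 1 and Appendix A. [`CohnKumar2006`]
-/

noncomputable section

namespace Summit.Ventures.PackingBounds.Config.SixHundredCellCode

open Finset Module Literature.Analysis.SpecialFunctions Literature.Geometry.DiscreteGeometry CliqueFrame

/-! ### The nine inner products as digits, and the integer norm test -/

/-- Rational part `A_d` of `4 ×` the `d`-th inner product (`d = 0…8`: `1, t, 1/2, (√5-1)/4, 0, (1-√5)/4, -1/2, -t, -1`). -/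
def vA : ℕ → ℤ := fun d => match d with
  | 0 => 4 | 1 => 1 | 2 => 2 | 3 => -1 | 4 => 0 | 5 => 1 | 6 => -2 | 7 => -1 | 8 => -4 | _ => 0

/-- `√5`-part `B_d` of `4 ×` the `d`-th inner product. -/
def vB : ℕ → ℤ := fun d => match d with
  | 1 => 1 | 3 => 1 | 5 => -1 | 7 => -1 | _ => 0

/-- The `d`-th inner product value `(A_d + B_d √5)/4`. -/
def val9 (d : ℕ) : ℝ := ((vA d : ℝ) + (vB d : ℝ) * Real.sqrt 5) / 4

/-- **The integer norm test** on a digit string `(d₀, d₁, d₂, d₃)`: the unit-norm identity against a `t`-frame,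
`(1+3t)(1-t) = (1+3t) Σ bⱼ² - t (Σ bⱼ)²` with `bⱼ = val9 dⱼ`, split into its rational and `√5` parts. -/
def testDigits (d₀ d₁ d₂ d₃ : ℕ) : Bool :=
  let P : ℤ := (vA d₀ ^ 2 + 5 * vB d₀ ^ 2) + (vA d₁ ^ 2 + 5 * vB d₁ ^ 2) + (vA d₂ ^ 2 + 5 * vB d₂ ^ 2) +
    (vA d₃ ^ 2 + 5 * vB d₃ ^ 2)
  let Q : ℤ := 2 * (vA d₀ * vB d₀ + vA d₁ * vB d₁ + vA d₂ * vB d₂ + vA d₃ * vB d₃)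
  let a : ℤ := vA d₀ + vA d₁ + vA d₂ + vA d₃
  let b : ℤ := vB d₀ + vB d₁ + vB d₂ + vB d₃
  (7 * P + 15 * Q - a ^ 2 - 5 * b ^ 2 - 10 * a * b == 24) && (3 * P + 7 * Q - a ^ 2 - 5 * b ^ 2 - 2 * a * b == 8)

/-- The `120` digit strings passing the test, encoded in base `9` (`n = d₀ + 9 d₁ + 81 d₂ + 729 d₃`). -/
def codeList : List ℕ :=
  [819, 811, 739, 91, 1549, 901, 1630, 829, 1558, 910, 2368, 1720, 1648, 821, 1550, 902, 2360, 1712, 830, 2288, 992,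
   3179, 2531, 1568, 920, 3107, 1811, 3269, 2387, 1739, 3197, 2549, 3278, 1632, 1560, 912, 3099, 1803, 3261, 1659, 3117,
   1821, 4008, 3360, 3288, 2371, 1723, 3181, 2533, 3262, 1651, 3109, 1813, 4000, 3352, 2389, 3118, 1741, 3928, 1822, 4738,
   2632, 4819, 3442, 4171, 3208, 2560, 4747, 3451, 4909, 3298, 4027, 3379, 4837, 4189, 3272, 3200, 2552, 4739, 3443, 4901,
   3299, 4757, 3461, 5648, 5000, 4928, 3282, 4011, 3363, 4821, 4173, 3291, 4749, 3453, 5640, 4992, 4029, 3381, 5568, 4272,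
   5730, 4848, 4200, 5658, 5010, 5739, 4912, 4840, 4192, 5650, 5002, 5731, 4930, 5659, 5011, 6469, 5821, 5749, 5741]

/-- Kernel check: `codeList` has `120` entries. -/
theorem length_codeList : codeList.length = 120 := by decide

set_option maxRecDepth 100000 in
/-- **Kernel enumeration: exactly the `120` listed digit strings pass the norm test** (all `9⁴` strings checked). -/
theorem mem_codeList_of_test : ∀ n < 6561,
    testDigits (n % 9) (n / 9 % 9) (n / 81 % 9) (n / 729 % 9) = true → n ∈ codeList := by
  decide +kernel

/-- The `j`-th digit of a code. -/
def digit (n : ℕ) (j : Fin 4) : ℕ := n / 9 ^ (j : ℕ) % 9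

/-- The coefficients of the member of the family with code `n` against the frame (`CliqueFrame.repr_formula`). -/
def coefR (n : ℕ) (j : Fin 4) : ℝ :=
  (val9 (digit n j) - (1 + Real.sqrt 5) / 4 * (∑ i, val9 (digit n i)) / (1 + ((4 : ℝ) - 1) * ((1 + Real.sqrt 5) / 4)))
    / (1 - (1 + Real.sqrt 5) / 4)

/-- The family: member `k` over the frame `a`. -/
def famC (a : Fin 4 → EuclideanSpace ℝ (Fin 4)) (k : Fin 120) : EuclideanSpace ℝ (Fin 4) :=
  ∑ j, coefR (codeList.getD k 0) j • a j

/-- `m + n √5 = 0` with integers `m, n` forces `m = n = 0`. -/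
theorem int_eq_zero_of_add_mul_sqrt5 {m n : ℤ} (h : (m : ℝ) + (n : ℝ) * Real.sqrt 5 = 0) : m = 0 ∧ n = 0 := by
  have hinj := Zsqrtd.toReal_injective Icosahedron.h5 Icosahedron.d5_not_square
  have : Zsqrtd.toReal Icosahedron.h5 (⟨m, n⟩ : Zsqrtd 5) = Zsqrtd.toReal Icosahedron.h5 0 := by
    rw [Zsqrtd.toReal_apply, map_zero]; push_cast; linarith
  have h0 := hinj this
  exact ⟨congrArg Zsqrtd.re h0, congrArg Zsqrtd.im h0⟩

section config

variable {C : Finset (EuclideanSpace ℝ (Fin 4))} (h1 : ∀ x ∈ C, ‖x‖ = 1)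
  (h2 : ∀ x ∈ C, ∀ y ∈ C, x ≠ y → inner ℝ x y ≤ (1 + Real.sqrt 5) / 4) (hN : C.card = 120)
  {a : Fin 4 → EuclideanSpace ℝ (Fin 4)} (ha : ∀ i, a i ∈ C)
  (hG : ∀ i j, inner ℝ (a i) (a j) = if i = j then 1 else (1 + Real.sqrt 5) / 4)
include h1 h2 hN ha hG

omit hG in
/-- Every inner product of a point of the code with a frame vector is one of the nine digit values. -/
theorem exists_digit {z : EuclideanSpace ℝ (Fin 4)} (hz : z ∈ C) (j : Fin 4) :
    ∃ d, d < 9 ∧ inner ℝ z (a j) = val9 d := by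
  by_cases hza : z = a j
  · refine ⟨0, by norm_num, ?_⟩
    rw [hza, real_inner_self_eq_norm_sq, h1 _ (ha j)]
    simp only [val9, vA, vB]; push_cast; ring
  rcases inner_mem_of_card_eq_120 h1 h2 hN hz (ha j) hza with h | h | h | h | h | h | h | h
  · exact ⟨1, by norm_num, by rw [h]; simp only [val9, vA, vB]; push_cast; ring⟩
  · exact ⟨2, by norm_num, by rw [h]; simp only [val9, vA, vB]; push_cast; ring⟩
  · exact ⟨3, by norm_num, by rw [h]; simp only [val9, vA, vB]; push_cast; ring⟩
  · exact ⟨4, by norm_num, by rw [h]; simp only [val9, vA, vB]; push_cast; ring⟩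
  · exact ⟨5, by norm_num, by rw [h]; simp only [val9, vA, vB]; push_cast; ring⟩
  · exact ⟨6, by norm_num, by rw [h]; simp only [val9, vA, vB]; push_cast; ring⟩
  · exact ⟨7, by norm_num, by rw [h]; simp only [val9, vA, vB]; push_cast; ring⟩
  · exact ⟨8, by norm_num, by rw [h]; simp only [val9, vA, vB]; push_cast; ring⟩

/-- **Every point of the code is a member of the fixed family over the frame.** -/
theorem exists_index {z : EuclideanSpace ℝ (Fin 4)} (hz : z ∈ C) : ∃ k : Fin 120, z = famC a k := by
  classical
  obtain ⟨hX, hlo, hhi⟩ := sqrt5_facts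
  choose c hc9 hcv using fun j => exists_digit h1 h2 hN ha hz j
  -- the code of `z`
  set n : ℕ := c 0 + 9 * c 1 + 81 * c 2 + 729 * c 3 with hn
  have hc0 := hc9 0; have hc1 := hc9 1; have hc2 := hc9 2; have hc3 := hc9 3
  have hlt : n < 6561 := by omega
  have hd0 : n % 9 = c 0 := by omega
  have hd1 : n / 9 % 9 = c 1 := by omega
  have hd2 : n / 81 % 9 = c 2 := by omega
  have hd3 : n / 729 % 9 = c 3 := by omega
  have hdig : ∀ j : Fin 4, digit n j = c j := by
    intro j; fin_cases j <;> simp [digit, hd0, hd1, hd2, hd3]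
  -- the norm identity against the frame, as two integer equations
  have hcard : Fintype.card (Fin 4) = finrank ℝ (EuclideanSpace ℝ (Fin 4)) := by simp
  have ht0 : (0 : ℝ) ≤ (1 + Real.sqrt 5) / 4 := by positivity
  have ht1 : (1 + Real.sqrt 5) / 4 < 1 := by nlinarith [hlo, hhi]
  have hnorm := norm_identity hG ht0 ht1 hcard z
  simp only [Fintype.card_fin, Nat.cast_ofNat, h1 z hz, Fin.sum_univ_four, hcv] at hnorm
  simp only [val9] at hnorm
  set A0 : ℤ := vA (c 0); set A1 : ℤ := vA (c 1); set A2 : ℤ := vA (c 2); set A3 : ℤ := vA (c 3)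
  set B0 : ℤ := vB (c 0); set B1 : ℤ := vB (c 1); set B2 : ℤ := vB (c 2); set B3 : ℤ := vB (c 3)
  have key : (((7 * ((A0 ^ 2 + 5 * B0 ^ 2) + (A1 ^ 2 + 5 * B1 ^ 2) + (A2 ^ 2 + 5 * B2 ^ 2) + (A3 ^ 2 + 5 * B3 ^ 2)) + 15 * (2 * (A0 * B0 + A1 * B1 + A2 * B2 + A3 * B3)) - (A0 + A1 + A2 + A3) ^ 2 - 5 * (B0 + B1 + B2 + B3) ^ 2 - 10 * (A0 + A1 + A2 + A3) * (B0 + B1 + B2 + B3) - 24 : ℤ)) : ℝ)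
      + (((3 * ((A0 ^ 2 + 5 * B0 ^ 2) + (A1 ^ 2 + 5 * B1 ^ 2) + (A2 ^ 2 + 5 * B2 ^ 2) + (A3 ^ 2 + 5 * B3 ^ 2)) + 7 * (2 * (A0 * B0 + A1 * B1 + A2 * B2 + A3 * B3)) - (A0 + A1 + A2 + A3) ^ 2 - 5 * (B0 + B1 + B2 + B3) ^ 2 - 2 * (A0 + A1 + A2 + A3) * (B0 + B1 + B2 + B3) - 8 : ℤ)) : ℝ) * Real.sqrt 5
      = 0 := by
    push_cast
    linear_combination (-64) * hnorm - ((7 + 3 * Real.sqrt 5) * ((B0 : ℝ) ^ 2 + (B1 : ℝ) ^ 2 + (B2 : ℝ) ^ 2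
      + (B3 : ℝ) ^ 2) + 3 * (2 * ((A0 : ℝ) * B0 + (A1 : ℝ) * B1 + (A2 : ℝ) * B2 + (A3 : ℝ) * B3))
      - (1 + Real.sqrt 5) * ((B0 : ℝ) + B1 + B2 + B3) ^ 2
      - 2 * ((A0 : ℝ) + A1 + A2 + A3) * ((B0 : ℝ) + B1 + B2 + B3) + 12) * hX
  obtain ⟨hm, hn'⟩ := int_eq_zero_of_add_mul_sqrt5 key
  have htest : testDigits (n % 9) (n / 9 % 9) (n / 81 % 9) (n / 729 % 9) = true := by
    rw [hd0, hd1, hd2, hd3]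
    simp only [testDigits, Bool.and_eq_true, beq_iff_eq]
    constructor <;> linarith
  -- look the code up
  have hmem := mem_codeList_of_test n hlt htest
  obtain ⟨i, hi, hin⟩ := List.mem_iff_getElem.mp hmem
  rw [length_codeList] at hi
  refine ⟨⟨i, hi⟩, ?_⟩
  have hcode : codeList.getD (⟨i, hi⟩ : Fin 120) 0 = n := by
    have hi' : i < codeList.length := by rw [length_codeList]; exact hi
    rw [List.getD_eq_getElem?_getD, List.getElem?_eq_getElem hi', Option.getD_some]
    exact hin
  -- the representation formula
  have hrepr := repr_formula hG ht0 ht1 hcard z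
  simp only [Fintype.card_fin, Nat.cast_ofNat] at hrepr
  rw [famC, hcode]
  conv_lhs => rw [hrepr]
  refine Finset.sum_congr rfl fun j _ => ?_
  simp only [coefR, hdig, hcv]

/-- **The code is the image of the fixed family over the frame.** -/
theorem eq_image : C = univ.image (famC a) := by
  classical
  exact eq_image_of_forall_exists C _ (fun z hz => exists_index h1 h2 hN ha hG hz) (by simp [hN])

end config

/-! ### Uniqueness -/

/-- **Uniqueness of the `(4, 120, cos 36°)` code.** Any two `120`-point codes in `ℝ⁴` with pairwise inner products
`≤ (1+√5)/4` are isometric. [cite: CohnKumar2006, Appendix A] -/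
theorem isometric {C C' : Finset (EuclideanSpace ℝ (Fin 4))} (h1 : ∀ x ∈ C, ‖x‖ = 1)
    (h2 : ∀ x ∈ C, ∀ y ∈ C, x ≠ y → inner ℝ x y ≤ (1 + Real.sqrt 5) / 4) (hN : C.card = 120)
    (h1' : ∀ x ∈ C', ‖x‖ = 1) (h2' : ∀ x ∈ C', ∀ y ∈ C', x ≠ y → inner ℝ x y ≤ (1 + Real.sqrt 5) / 4)
    (hN' : C'.card = 120) :
    ∃ Ψ : EuclideanSpace ℝ (Fin 4) ≃ₗᵢ[ℝ] EuclideanSpace ℝ (Fin 4), C' = C.image Ψ := by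
  classical
  obtain ⟨a, ha, hG⟩ := exists_frame h1 h2 hN
  obtain ⟨a', ha', hG'⟩ := exists_frame h1' h2' hN'
  have hgram : ∀ k l, inner ℝ (famC a k) (famC a l) = inner ℝ (famC a' k) (famC a' l) := by
    intro k l
    simp only [famC]
    rw [inner_combo_combo hG, inner_combo_combo hG']
  obtain ⟨Ψ, hΨ⟩ := exists_linearIsometryEquiv_of_inner_eq _ _ hgram
  refine ⟨Ψ, ?_⟩
  rw [eq_image h1' h2' hN' ha' hG', eq_image h1 h2 hN ha hG, Finset.image_image]
  exact Finset.image_congr fun k _ => (hΨ k).symm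

/-- Kernel check: the 600-cell's coordinate lists have length `4` and squared length `16`. -/
private theorem cell_shape : shapeOK SixHundredCell.vecs 4 (⟨16, 0⟩ : Zsqrtd 5) = true := by decide +kernel

/-- **The 600-cell is the unique such configuration**: every `120`-point code in `ℝ⁴` with pairwise inner
products `≤ (1+√5)/4` is an isometric image of `Config.SixHundredCell.pts`. [cite: CohnKumar2006, Appendix A] -/
theorem isometric_pts {C : Finset (EuclideanSpace ℝ (Fin 4))} (h1 : ∀ x ∈ C, ‖x‖ = 1)
    (h2 : ∀ x ∈ C, ∀ y ∈ C, x ≠ y → inner ℝ x y ≤ (1 + Real.sqrt 5) / 4) (hN : C.card = 120) :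
    ∃ Ψ : EuclideanSpace ℝ (Fin 4) ≃ₗᵢ[ℝ] EuclideanSpace ℝ (Fin 4), C = SixHundredCell.pts.image Ψ := by
  classical
  obtain ⟨hX, hlo, hhi⟩ := sqrt5_facts
  have hq : 0 < (Zsqrtd.toReal Icosahedron.h5) (⟨16, 0⟩ : Zsqrtd 5) := by
    rw [Zsqrtd.toReal_apply]; norm_num
  have hn1 : ∀ x ∈ SixHundredCell.pts, ‖x‖ = 1 := norm_eq_one hq cell_shape
  -- the 600-cell is a code of angle `36°`: read off its energy identity with an indicator potential
  have hle : ∀ x ∈ SixHundredCell.pts, ∀ y ∈ SixHundredCell.pts, x ≠ y → inner ℝ x y ≤ (1 + Real.sqrt 5) / 4 := by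
    set ind : ℝ → ℝ := fun s => if s ≤ (1 + Real.sqrt 5) / 4 then 0 else 1 with hind
    have hE := SixHundredCell.energy_pts ind
    have hval : ind (-1) = 0 ∧ ind ((-1 / 4 : ℝ) + (-1 / 4 : ℝ) * Real.sqrt 5) = 0 ∧ ind (-1 / 2) = 0 ∧
        ind ((1 / 4 : ℝ) + (-1 / 4 : ℝ) * Real.sqrt 5) = 0 ∧ ind 0 = 0 ∧
        ind ((-1 / 4 : ℝ) + (1 / 4 : ℝ) * Real.sqrt 5) = 0 ∧ ind (1 / 2) = 0 ∧
        ind ((1 / 4 : ℝ) + (1 / 4 : ℝ) * Real.sqrt 5) = 0 := by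
      simp only [hind]
      refine ⟨?_, ?_, ?_, ?_, ?_, ?_, ?_, ?_⟩ <;> (rw [if_pos]; nlinarith [hlo, hhi])
    rw [hval.1, hval.2.1, hval.2.2.1, hval.2.2.2.1, hval.2.2.2.2.1, hval.2.2.2.2.2.1, hval.2.2.2.2.2.2.1,
      hval.2.2.2.2.2.2.2] at hE
    norm_num at hE
    have hnn : ∀ x ∈ SixHundredCell.pts, ∀ y ∈ SixHundredCell.pts.erase x, 0 ≤ ind (inner ℝ x y) := by
      intro x _ y _; simp only [hind]; split_ifs <;> norm_num
    intro x hx y hy hxy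
    have hx0 := (Finset.sum_eq_zero_iff_of_nonneg fun x hx => Finset.sum_nonneg fun y hy => hnn x hx y hy).mp hE x hx
    have h0 := (Finset.sum_eq_zero_iff_of_nonneg fun y hy => hnn x hx y hy).mp hx0 y
      (Finset.mem_erase.mpr ⟨hxy.symm, hy⟩)
    simp only [hind] at h0
    by_contra hc
    rw [if_neg hc] at h0
    exact one_ne_zero h0
  exact isometric hn1 hle SixHundredCell.card_pts h1 h2 hN

/-- **Ground-state form**: every `120`-point configuration on `S³` attaining the universal lower bound of the
`(1+t)^k`-energy for one `k ≥ 18` is an isometric image of the 600-cell — the 600-cell is the unique ground state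
(Cohn–Kumar Thm 1.2, uniqueness for the 600-cell row). [cite: CohnKumar2006, Theorem 1.2 and Appendix A] -/
theorem isometric_pts_of_ckPow_energy_eq {C : Finset (EuclideanSpace ℝ (Fin 4))} (h1 : ∀ x ∈ C, ‖x‖ = 1)
    (hN : C.card = 120) (k : ℕ) (hk : 18 ≤ k)
    (hE : ∑ x ∈ C, ∑ y ∈ C.erase x, (1 + inner ℝ x y) ^ k =
      (120 : ℝ) * ((1 + (-1 : ℝ)) ^ k + 12 * (1 + ((-1 / 4 : ℝ) + (-1 / 4 : ℝ) * Real.sqrt 5)) ^ k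
        + 20 * (1 + (-1 / 2 : ℝ)) ^ k + 12 * (1 + ((1 / 4 : ℝ) + (-1 / 4 : ℝ) * Real.sqrt 5)) ^ k
        + 30 * (1 + (0 : ℝ)) ^ k + 12 * (1 + ((-1 / 4 : ℝ) + (1 / 4 : ℝ) * Real.sqrt 5)) ^ k
        + 20 * (1 + (1 / 2 : ℝ)) ^ k + 12 * (1 + ((1 / 4 : ℝ) + (1 / 4 : ℝ) * Real.sqrt 5)) ^ k)) :
    ∃ Ψ : EuclideanSpace ℝ (Fin 4) ≃ₗᵢ[ℝ] EuclideanSpace ℝ (Fin 4), C = SixHundredCell.pts.image Ψ := by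
  refine isometric_pts h1 (fun x hx y hy hxy => ?_) hN
  have h := SixHundredCellEnergyRigidity.inner_le_of_ckPow_energy_eq h1 hN k hk hE x hx y hy hxy
  linarith

end Summit.Ventures.PackingBounds.Config.SixHundredCellCode

end
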